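import Literature.NumberTheory.Automorphic.IntertwiningMapTransport              -- ★ `exists_normalizedJacquet_shortExact`, `exists_normalizedJacquet_intertwiningMap_apply_mk`
import Literature.NumberTheory.Automorphic.UnitaryGroupPrincipalSeriesExponents   -- ★ `Representation.HasJacquetExponent`
import Literature.NumberTheory.Automorphic.ParabolicInductionQuotientProofs        -- ★ `Subrepresentation.quotientRep`, `Subrepresentation.mkQ`
import Literature.RepresentationTheory.FiniteGroups.EquivOfCharacter              -- ★ `Subrepresentation.subtypeIntertwiningMap`
import HarnessLib

/-!
# Exponents along a short exact sequence: every exponent of the middle term is an exponent of an end term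
# (Bernstein–Zelevinsky 1977 §1.9, §2.3; Casselman 1995 §3.2, §4.4; Waldspurger 2003 III.1)

Topic `NumberTheory/Automorphic`; namespace `Representation`.  THEOREMS ONLY (no definition, no named fact, no instance, no notation, no `sorry`).
Cell `hodgecm-mathlib`, E1 row 71 «(S1) CASSELMAN'S CRITERION IN RANK ONE» (census `CENSUS-R71-CasselmanRankOne.v1`, item (E)); seat «LH6» LH6-p03 (g9).

SETTING.  `G` a topological group, `t = (P, M, N)` a parabolic triple with `N` a union of compact open subgroups (★ `IsLimitOfCompactOpen t.N`),
`0 → π₁ →ᶠ π₂ →ᵍ π₃ → 0` a short exact sequence of representations with `π₂` smooth.  An EXPONENT of `π` along `P` is a character `χ : M →* ℂˣ`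
carried by a non-zero eigenvector of the normalised Jacquet module `r_P π = π_N ⊗ δ_P^{-1∕2}` (★ `Representation.HasJacquetExponent`, eigenvector form).

RESULTS.
* §1 `hasJacquetExponent_of_injective` ∕ `hasJacquetExponent_of_intertwiningMap_of_ne_zero` — transport of an eigenvector along an injective `M`-map, resp. along
  any `G`-map that does not kill it.
* §2 **`hasJacquetExponent_of_shortExact`** — every exponent of `π₂` is an exponent of `π₁` or of `π₃`: by the exactness of the normalised Jacquet functor
  (★ `exists_normalizedJacquet_shortExact`: `0 → r_P π₁ →ᶠ r_P π₂ →ᴳ r_P π₃ → 0`) a `χ`-eigenvector `w ≠ 0` of `r_P π₂` either survives in `r_P π₃` (then `G w` is a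
  `χ`-eigenvector there) or lies in `ker G = range F`, `w = F y`, and `F` injective makes `y` a `χ`-eigenvector of `r_P π₁`.  No generalized eigenspaces and no
  «set of exponents» are needed: this is the eigenvector-level content of `Exp(r_P π₂) = Exp(r_P π₁) ∪ Exp(r_P π₃)` [Waldspurger2003, III.1; BernsteinZelevinsky1977, 2.13].
* §3 `hasJacquetExponent_sub_or_quotient` — the subrepresentation form: an exponent of `π` is an exponent of `π|_N'` or of `π ⁄ N'` for every `G`-stable `N'`.

USE.  With ★ `F0P3U3SquareIntegrableExponentsHolds.perPlace_fwd ∕ perPlace_bwd` (Casselman's criterion for `U(3)(L⁺_v)`, both directions) this gives «a length-two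
admissible representation with a central character whose two subquotients are square-integrable modulo the centre is square-integrable modulo the centre»
(the K2′-`L²` road's (S1)); iterating along a composition series gives the finite-length statement.

HONEST LABEL: generic, count-neutral; HC_CM is proved only modulo the 7 printed citations (2 remaining: hLiu418 = stmt-HodgeConjecture-24832, h413 =
stmt-HodgeConjecture-24833) until rung 0 closes.
## References
* [BernsteinZelevinsky1977] I. N. Bernstein, A. V. Zelevinsky, *Induced representations of reductive p-adic groups I*, Ann. Sci. ÉNS 10 (1977), §1.9 Prop. 1.9,
  §2.3, Cor. 2.13.
* [Casselman1995] W. Casselman, *Introduction to the theory of admissible representations of p-adic reductive groups* (draft 1995), §3.2 Thm. 3.2.3, §4.4 p. 45.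
* [Waldspurger2003] J.-L. Waldspurger, *La formule de Plancherel pour les groupes p-adiques (d'après Harish-Chandra)*, J. Inst. Math. Jussieu 2 (2003), III.1 p. 263.
-/

set_option autoImplicit false

noncomputable section

open Literature.NumberTheory.Automorphic Literature.RepresentationTheory.FiniteGroups

namespace Representation

variable {G : Type*} [Group G] [TopologicalSpace G] [IsTopologicalGroup G]
  (t : ParabolicTriple G) [LocallyCompactSpace t.P]
  {V₁ V₂ V₃ : Type*} [AddCommGroup V₁] [Module ℂ V₁] [AddCommGroup V₂] [Module ℂ V₂] [AddCommGroup V₃] [Module ℂ V₃]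
  {ρ₁ : Representation ℂ G V₁} {ρ₂ : Representation ℂ G V₂} {ρ₃ : Representation ℂ G V₃}

/-! ## §1 Transport of eigenvectors along `M`-maps of normalised Jacquet modules -/

/-- An exponent is transported BACK along an INJECTIVE `M`-map of normalised Jacquet modules hitting the eigenvector: if `F : r_P π₁ → r_P π₂` is an
injective `M`-map and `F y` is a non-zero `χ`-eigenvector, then `y` is one. [cite: BernsteinZelevinsky1977, §1.9] [cite: Casselman1995, §3.2] -/
theorem hasJacquetExponent_of_injective (F : (ρ₁.normalizedJacquet t).IntertwiningMap (ρ₂.normalizedJacquet t)) (hF : Function.Injective F)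
    {χ : ↥t.M →* ℂˣ} {y : (t.restrict ρ₁).Coinvariants} (hy : F y ≠ 0) (hχ : ∀ m : ↥t.M, ρ₂.normalizedJacquet t m (F y) = ((χ m : ℂˣ) : ℂ) • F y) :
    ρ₁.HasJacquetExponent t χ := by
  refine ⟨y, fun h => hy (by rw [h, map_zero]), fun m => hF ?_⟩
  rw [F.isIntertwining, hχ m, map_smul]

/-- An exponent is transported FORWARD along any `M`-map of normalised Jacquet modules that does not kill the eigenvector. [cite: BernsteinZelevinsky1977, §1.9] -/
theorem hasJacquetExponent_of_apply_ne_zero (G' : (ρ₂.normalizedJacquet t).IntertwiningMap (ρ₃.normalizedJacquet t))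
    {χ : ↥t.M →* ℂˣ} {w : (t.restrict ρ₂).Coinvariants} (hw : G' w ≠ 0) (hχ : ∀ m : ↥t.M, ρ₂.normalizedJacquet t m w = ((χ m : ℂˣ) : ℂ) • w) :
    ρ₃.HasJacquetExponent t χ :=
  ⟨G' w, hw, fun m => by rw [← G'.isIntertwining, hχ m, map_smul]⟩

/-! ## §2 Exponents along a short exact sequence -/

/-- **EVERY EXPONENT OF THE MIDDLE TERM OF A SHORT EXACT SEQUENCE IS AN EXPONENT OF AN END TERM.**  `0 → π₁ →ᶠ π₂ →ᵍ π₃ → 0` exact, `π₂` smooth, `N` a union of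
compact open subgroups: if `χ` is an exponent of `π₂` along `P` then `χ` is an exponent of `π₁` or of `π₃` (exactness of the normalised Jacquet functor ★
`exists_normalizedJacquet_shortExact`; eigenvector chase). [cite: BernsteinZelevinsky1977, §1.9 Prop. 1.9, §2.3 Cor. 2.13] [cite: Casselman1995, §3.2 Thm. 3.2.3; §4.4]
[cite: Waldspurger2003, III.1 p. 263] -/
theorem hasJacquetExponent_of_shortExact (hN : IsLimitOfCompactOpen t.N) (h₂ : ρ₂.IsSmooth)
    (f : ρ₁.IntertwiningMap ρ₂) (g : ρ₂.IntertwiningMap ρ₃)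
    (hf : Function.Injective f) (hfg : Function.Exact f g) (hg : Function.Surjective g)
    {χ : ↥t.M →* ℂˣ} (h : ρ₂.HasJacquetExponent t χ) :
    ρ₁.HasJacquetExponent t χ ∨ ρ₃.HasJacquetExponent t χ := by
  obtain ⟨F, G', -, -, hFi, hex, -⟩ := exists_normalizedJacquet_shortExact t hN h₂ f g hf hfg hg
  obtain ⟨w, hw0, hw⟩ := h
  by_cases hGw : G' w = 0
  · -- `w ∈ ker G = range F`
    obtain ⟨y, rfl⟩ := (hex w).1 hGw
    exact Or.inl (hasJacquetExponent_of_injective t F hFi hw0 hw)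
  · exact Or.inr (hasJacquetExponent_of_apply_ne_zero t G' hGw hw)

/-! ## §3 The subrepresentation form -/

/-- The subrepresentation form of §2: for every `G`-stable `N' ≤ π` (`π` smooth), an exponent of `π` is an exponent of `π|_{N'}` or of `π ⁄ N'`
(`0 → N' → π → π⁄N' → 0` with ★ `Subrepresentation.subtypeIntertwiningMap`, ★ `Subrepresentation.mkQ`). [cite: BernsteinZelevinsky1977, §2.3 Cor. 2.13]
[cite: Casselman1995, §4.4] -/
theorem hasJacquetExponent_sub_or_quotient (hN : IsLimitOfCompactOpen t.N) (h₂ : ρ₂.IsSmooth) (N' : Subrepresentation ρ₂)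
    {χ : ↥t.M →* ℂˣ} (h : ρ₂.HasJacquetExponent t χ) :
    N'.toRepresentation.HasJacquetExponent t χ ∨ N'.quotientRep.HasJacquetExponent t χ := by
  refine hasJacquetExponent_of_shortExact t hN h₂ (Subrepresentation.subtypeIntertwiningMap N') N'.mkQ Subtype.val_injective ?_ N'.mkQ_surjective h
  intro v
  constructor
  · intro hv
    exact ⟨⟨v, (N'.mkQ_eq_zero_iff v).1 hv⟩, rfl⟩
  · rintro ⟨y, rfl⟩
    exact (N'.mkQ_eq_zero_iff _).2 y.2

end Representation

end
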